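import Mathlib
import Literature.NumberTheory.DiophantineGeometry.RealPlaneCurveBranches
import Summits.KontsevichZagierPeriods.KontsevichZagierPeriods.Theorems.InverseLandauTateFamilyKernelStubGvDivision

/-!
# Crux `TateFamilyKernel` (stmt-KontsevichZagierPeriods-9130), line `Sketch`: stub `stub_gwDivision`

Step GW3′ (FACTOR THEOREM ⇒ TWISTED IDENTITY, with descent of coefficients `ℝ → ℚ`) of the
graph-pencil class with a general polynomial slope `Q = 1 − ϖ·(u(z₂) + v(z₂)z₁)`
(`u, v ∈ ℚ[s]`, `v ≠ 0` on `[0,1]`) of the lead's skeleton of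
`Summit.KontsevichZagierPeriods.KontsevichZagierPeriods.Theses.InverseLandau.TateFamilyKernel`
(variables `X 0 = y` resp. `z₁`, `X 1 = s = z₂`). Input: a rational primitive `Rn(y,σ)/v(σ)^k`
with REAL coefficients (step GW3) of the single-branch integrand
`f(y,σ) = P((y − u(σ))/v(σ), σ)/v(σ)` on `ℝ × [0,1]`, and the vanishing of `∫_s^1 f(W(s),σ) dσ`
along the graph `W = u + v` for `s ∈ (s₁,1)`. Output: the TWISTED IDENTITY
`v^m·P = (u' + v'z₁)·∂₀Nt − v·∂₁Nt + m v'·Nt` with a RATIONAL `Nt` (consumed by GW4).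

1. *Two real polynomial identities* (inside `stub_gwDivision`; the exponent is first raised to
   `k + 1` by `Rn ↦ Rn·v`). Uniqueness of the derivative (`GwDivision.key_identity`) read at the
   points `y = u(σ) + v(σ)x`, `σ ∈ [0,1]`, gives `I : P·v^{k+1} = v·θ(∂₁Rn) − (k+1)v'·θ(Rn)` in
   `ℝ[x, s]` (`θ : y ↦ u + v·x` inverts `P ↦ P((y−u)/v, s)`, so no denominator is cleared;
   polynomials agreeing on `ℝ × [0,1]` are equal, `GwDivision.eq_of_eval_eq`). The FTC
   (`intervalIntegral.integral_eq_sub_of_hasDerivAt`) and the hypothesis along the graph give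
   `c·Rn(W(s),s) = v(s)^{k+1}·Rn(W(s),1)` for `s ∈ (s₁,1)` (`c = v(1)^{k+1} ≠ 0`), i.e.
   `J : (c·Rn − v^{k+1}·Rn(y,1))(W(s), s) = 0` in `ℝ[x, s]`. The injectivity of `W` is not
   needed for this (the root argument runs in the variable `s`).
2. *Descent* (`GwDivision.exists_retraction`): a `ℚ`-linear retraction `π : ℝ → ℚ` of the
   inclusion (`LinearMap.exists_leftInverse_of_injective`) applied coefficientwise is additive,
   fixes rational polynomials, is linear over multiplication by rational polynomials and commutes
   with `pderiv` and with rational substitutions; `I` and `J` are `ℚ`-linear in `Rn` with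
   rational coefficients, so they hold for the RATIONAL polynomial `ρ(Rn)`.
3. *Factor theorem and chain rule over `ℚ`* (`GwDivision.twisted`, the pattern of
   `GvDivision.twisted` with the slope `γ + δs` replaced by `v(s)` and `δ` by `v'(s)`):
   `c·R − v^{k+1}·R(y,1) = (y − W)·G` (`GpDivision.X_sub_dvd`); differentiating in `s`,
   applying `θ`, cancelling one factor `v` and the chain rule (`LinExact.pderiv_bind₁`) give
   `Nt = (1 − z₁)·θ(G)/c` and `m = k`.

References: Kontsevich–Zagier 2001, §1.2. Mathlib, the landed files `…StubGpDivision`,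
`…StubGvDivision`, `…StubLinExact` and `Literature/…/RealPlaneCurveBranches` (the derivative of
a real polynomial function, `Dioph.hasDerivAt_eval_snd`) only; no named fact, no new definition.
Helpers live in the sub-namespace `GwDivision`.
-/

noncomputable section

open MeasureTheory Set MvPolynomial
open Literature.NumberTheory.Transcendental

namespace Summit.KontsevichZagierPeriods.InverseLandau.TateFamilyKernel.Descent

namespace GwDivision

/-- **Descent of coefficients.** A `ℚ`-linear retraction `π : ℝ → ℚ` of the inclusion
(`LinearMap.exists_leftInverse_of_injective`), applied coefficientwise, is an additive map
`ρ : ℝ[y, s] → ℚ[y, s]` which is the identity on rational polynomials, is linear over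
multiplication by rational polynomials, and commutes with the partial derivatives and with
substitutions of rational polynomials. [folklore] -/
theorem exists_retraction :
    ∃ ρ : MvPolynomial (Fin 2) ℝ →+ MvPolynomial (Fin 2) ℚ,
      (∀ (q : MvPolynomial (Fin 2) ℚ) (p : MvPolynomial (Fin 2) ℝ),
          ρ (map (algebraMap ℚ ℝ) q * p) = q * ρ p) ∧
      (∀ q : MvPolynomial (Fin 2) ℚ, ρ (map (algebraMap ℚ ℝ) q) = q) ∧
      (∀ (i : Fin 2) (p : MvPolynomial (Fin 2) ℝ), ρ (pderiv i p) = pderiv i (ρ p)) ∧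
      ∀ (f : Fin 2 → MvPolynomial (Fin 2) ℚ) (g : Fin 2 → MvPolynomial (Fin 2) ℝ),
        (∀ i, g i = map (algebraMap ℚ ℝ) (f i)) →
          ∀ p : MvPolynomial (Fin 2) ℝ, ρ (bind₁ g p) = bind₁ f (ρ p) := by
  obtain ⟨π, hπ⟩ := (Algebra.linearMap ℚ ℝ).exists_leftInverse_of_injective
    (LinearMap.ker_eq_bot.mpr fun a b h => (algebraMap ℚ ℝ).injective h)
  have hπι : ∀ a : ℚ, π (algebraMap ℚ ℝ a) = a := fun a => by
    simpa using LinearMap.congr_fun hπ a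
  -- the coefficientwise map
  obtain ⟨ρ, hρ⟩ : ∃ ρ : MvPolynomial (Fin 2) ℝ →+ MvPolynomial (Fin 2) ℚ,
      ∀ m p, coeff m (ρ p) = π (coeff m p) :=
    ⟨AddMonoidHom.mk' (AddMonoidAlgebra.map π.toAddMonoidHom) (AddMonoidAlgebra.map_add _),
      fun m p => rfl⟩
  have hmul : ∀ (q : MvPolynomial (Fin 2) ℚ) (p : MvPolynomial (Fin 2) ℝ),
      ρ (map (algebraMap ℚ ℝ) q * p) = q * ρ p := by
    intro q p
    refine MvPolynomial.ext _ _ fun m => ?_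
    rw [hρ, coeff_mul, coeff_mul, map_sum]
    refine Finset.sum_congr rfl fun x _ => ?_
    rw [coeff_map, hρ, ← Algebra.smul_def, map_smul, smul_eq_mul]
  have hC : ∀ a : ℝ, ρ (C a) = C (π a) := fun a => by
    refine MvPolynomial.ext _ _ fun m => ?_
    rw [hρ, coeff_C, coeff_C, apply_ite π, map_zero]
  refine ⟨ρ, hmul, fun q => ?_, fun i p => ?_, fun f g hfg p => ?_⟩
  · refine MvPolynomial.ext _ _ fun m => ?_
    rw [hρ, coeff_map, hπι]
  · refine MvPolynomial.ext _ _ fun m => ?_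
    rw [hρ, coeff_pderiv, coeff_pderiv, hρ,
      show coeff (m + Finsupp.single i 1) p * ((m i : ℝ) + 1) =
        ((m i : ℚ) + 1) • coeff (m + Finsupp.single i 1) p by
          rw [Algebra.smul_def, map_add, map_natCast, map_one, mul_comm],
      map_smul, smul_eq_mul, mul_comm]
  · induction p using MvPolynomial.induction_on with
    | C a => simp only [bind₁_C_right, hC]
    | add p q hp hq => simp only [map_add, hp, hq]
    | mul_X p i hp =>
      have h1 : ρ (p * X i) = ρ p * X i := by
        rw [show p * X i = map (algebraMap ℚ ℝ) (X i) * p by rw [map_X]; exact mul_comm _ _,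
          hmul]
        exact mul_comm _ _
      have h2 : bind₁ g (p * X i) = map (algebraMap ℚ ℝ) (f i) * bind₁ g p := by
        rw [map_mul, bind₁_X_right, hfg]
        exact mul_comm _ _
      rw [h2, hmul, hp, h1, map_mul, bind₁_X_right]
      exact mul_comm _ _

/-- Two real polynomials in `(y, s)` whose evaluations agree at every `(y, s)` with `s` in an
infinite set `S ⊆ ℝ` are equal (`MvPolynomial.funext_set`; real version of
`GpDivision.eq_zero_of_aeval_eq_zero`). [folklore] -/
theorem eq_of_eval_eq (p q : MvPolynomial (Fin 2) ℝ) (S : Set ℝ) (hS : S.Infinite)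
    (h : ∀ y : ℝ, ∀ s ∈ S, MvPolynomial.eval ![y, s] p = MvPolynomial.eval ![y, s] q) :
    p = q := by
  refine MvPolynomial.funext_set (![Set.univ, S] : Fin 2 → Set ℝ) (fun l => ?_) fun g hg => ?_
  · fin_cases l
    · exact Set.infinite_univ
    · exact hS
  · have hv : g = ![g 0, g 1] := by
      funext i
      fin_cases i <;> rfl
    rw [hv]
    exact h (g 0) (g 1) (hg 1 (Set.mem_univ _))

/-- Evaluating a substitution: `(bind₁ (f₀, f₁) R)(g) = R(f₀(g), f₁(g))` (real version of
`GvDivision.aeval_bind₁_vec`). [folklore] -/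
theorem eval_bind₁_vec (f₀ f₁ R : MvPolynomial (Fin 2) ℝ) (g : Fin 2 → ℝ) :
    MvPolynomial.eval g (bind₁ ![f₀, f₁] R) =
      MvPolynomial.eval ![MvPolynomial.eval g f₀, MvPolynomial.eval g f₁] R := by
  have hv : (fun i => MvPolynomial.eval g ((![f₀, f₁] : Fin 2 → MvPolynomial (Fin 2) ℝ) i)) =
      ![MvPolynomial.eval g f₀, MvPolynomial.eval g f₁] := by
    funext i
    fin_cases i <;> simp
  rw [← hv]
  exact eval₂Hom_bind₁ _ _ _ _

open Literature.NumberTheory.DiophantineGeometry in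
/-- **Uniqueness of the derivative, cleared of denominators**: if `d/dt (R(y,t)/v(t)^k) = φ` at
`t = σ` (`R ∈ ℝ[y, s]`, `v ∈ ℚ[s]`, `v(σ) ≠ 0`), then
`φ·v(σ)^{k+1} = (∂₁R)(y,σ)·v(σ) − k·v'(σ)·R(y,σ)`. [folklore] -/
theorem key_identity (v : Polynomial ℚ) (R : MvPolynomial (Fin 2) ℝ) (k : ℕ) (y σ φ : ℝ)
    (hv : Polynomial.aeval σ v ≠ 0)
    (hR : HasDerivAt
      (fun t : ℝ => MvPolynomial.eval (![y, t] : Fin 2 → ℝ) R / Polynomial.aeval t v ^ k) φ σ) :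
    φ * Polynomial.aeval σ v ^ (k + 1) =
      MvPolynomial.eval ![y, σ] (pderiv 1 R) * Polynomial.aeval σ v -
        k * Polynomial.aeval σ (Polynomial.derivative v) * MvPolynomial.eval ![y, σ] R := by
  -- adapted from `LinExact.key_identity`
  have h5 := hR.unique ((Dioph.hasDerivAt_eval_snd R y σ).div
    ((Polynomial.hasDerivAt_aeval v σ).fun_pow k) (pow_ne_zero k hv))
  have hk : (k : ℝ) * Polynomial.aeval σ v ^ (k - 1) * Polynomial.aeval σ v =
      k * Polynomial.aeval σ v ^ k := by
    cases k with
    | zero => simp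
    | succ n => rw [Nat.add_sub_cancel, pow_succ]; ring
  rw [eq_div_iff (pow_ne_zero 2 (pow_ne_zero k hv))] at h5
  apply mul_right_cancel₀ (pow_ne_zero k hv)
  linear_combination Polynomial.aeval σ v * h5 -
    MvPolynomial.eval ![y, σ] R * Polynomial.aeval σ (Polynomial.derivative v) * hk

/-- **Factor theorem and chain rule over `ℚ`** (the pattern of `GvDivision.twisted` for a
polynomial slope `w = v(s)`, `w' = v'(s)`; `Ud = u'(s)`, `A = u + w`, `A' = u + w·z₁`,
`θ = bind₁ (A', s)`). From the two identities `P·w^{k+1} = w·θ(∂₁R) − (k+1)w'·θ(R)` and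
`(c·R − w^{k+1}·R(y,1))(A, s) = 0` (`c ≠ 0`, `w ≠ 0`): `c·R − w^{k+1}R(y,1) = (y − A)·G`
(`GpDivision.X_sub_dvd`); differentiating in `s`, applying `θ` (`θ(y − A) = w(z₁ − 1)`),
cancelling one factor `w` and the chain rule (`LinExact.pderiv_bind₁`) give the twisted identity
`w^k P = (Ud + w'z₁)∂₀Nt − w∂₁Nt + k w' Nt` with `Nt = (1 − z₁)·θ(G)/c`.
[cite: KontsevichZagier2001, §1.2] -/
theorem twisted (u v : Polynomial ℚ) (P R : MvPolynomial (Fin 2) ℚ) (k : ℕ) (c : ℚ) (hc0 : c ≠ 0)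
    (w w' Ud A A' : MvPolynomial (Fin 2) ℚ) (hw : w = Polynomial.aeval (X 1) v)
    (hw' : w' = Polynomial.aeval (X 1) (Polynomial.derivative v))
    (hUd : Ud = Polynomial.aeval (X 1) (Polynomial.derivative u))
    (hA : A = Polynomial.aeval (X 1) u + w) (hA' : A' = Polynomial.aeval (X 1) u + w * X 0)
    (hwne : w ≠ 0)
    (hI : P * w ^ (k + 1) = w * bind₁ ![A', X 1] (pderiv 1 R) -
      ((k : MvPolynomial (Fin 2) ℚ) + 1) * w' * bind₁ ![A', X 1] R)
    (hJ : bind₁ ![A, X 1] (C c * R - w ^ (k + 1) * bind₁ ![X 0, 1] R) = 0) :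
    ∃ Nt : MvPolynomial (Fin 2) ℚ, w ^ k * P =
      (Ud + w' * X 0) * pderiv 0 Nt - w * pderiv 1 Nt + C (k : ℚ) * w' * Nt := by
  obtain ⟨Uu, hUu⟩ : ∃ Uu : MvPolynomial (Fin 2) ℚ, Uu = Polynomial.aeval (X 1) u := ⟨_, rfl⟩
  rw [← hUu] at hA hA'
  set R1 : MvPolynomial (Fin 2) ℚ := bind₁ ![X 0, 1] R with hR1
  have h10 : (1 : Fin 2) ≠ 0 := by decide
  have h01 : (0 : Fin 2) ≠ 1 := by decide
  -- derivatives of the scalar data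
  have hw0 : pderiv 0 w = 0 := by rw [hw, GpDivision.pderiv_zero_scalar]
  have hw1 : pderiv 1 w = w' := by rw [hw, hw', GpDivision.pderiv_one_scalar]
  have hA1 : pderiv 1 A = Ud + w' := by
    rw [hA, map_add, hUu, GpDivision.pderiv_one_scalar, ← hUd, hw1]
  have hA'0 : pderiv 0 A' = w := by
    rw [hA', map_add, hUu, GpDivision.pderiv_zero_scalar, pderiv_mul, hw0, pderiv_X_self]
    ring
  have hA'1 : pderiv 1 A' = Ud + w' * X 0 := by
    rw [hA', map_add, hUu, GpDivision.pderiv_one_scalar, ← hUd, pderiv_mul, hw1,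
      pderiv_X_of_ne h01, mul_zero, add_zero]
  have hwk : pderiv 1 (w ^ (k + 1)) = ((k : MvPolynomial (Fin 2) ℚ) + 1) * w ^ k * w' := by
    rw [Derivation.leibniz_pow, Nat.add_sub_cancel, hw1, smul_eq_mul, nsmul_eq_mul, Nat.cast_succ]
    ring
  have hR1d : pderiv 1 R1 = 0 := by simp [hR1, LinExact.pderiv_bind₁, Fin.sum_univ_two]
  -- the substitution `θ = bind₁ (A', s)`
  have hθ1 : (![A', X 1] : Fin 2 → MvPolynomial (Fin 2) ℚ) 1 = X 1 := by simp
  have hθU : bind₁ ![A', X 1] Uu = Uu := by rw [hUu, GpDivision.bind₁_scalar u _ hθ1]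
  have hθUd : bind₁ ![A', X 1] Ud = Ud := by rw [hUd, GpDivision.bind₁_scalar _ _ hθ1]
  have hθw : bind₁ ![A', X 1] w = w := by rw [hw, GpDivision.bind₁_scalar _ _ hθ1]
  have hθw' : bind₁ ![A', X 1] w' = w' := by rw [hw', GpDivision.bind₁_scalar _ _ hθ1]
  have hθA : bind₁ ![A', X 1] A = A := by rw [hA, map_add, hθU, hθw]
  have hθX : bind₁ ![A', X 1] (X 0 : MvPolynomial (Fin 2) ℚ) = A' := by simp
  have hAA' : A' - A = w * (X 0 - 1) := by rw [hA, hA']; ring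
  -- STEP C (factor theorem): `c·R − w^(k+1)·R1 = (y − A)·G`
  have h3 := GpDivision.X_sub_dvd A (C c * R - w ^ (k + 1) * R1)
  rw [hJ, sub_zero] at h3
  obtain ⟨G, hG⟩ := h3
  -- STEP D (differentiate in `s`, apply `θ`, combine with `hI`, cancel one `w`)
  have hE := congrArg (fun F => bind₁ ![A', X 1] (pderiv 1 F)) hG
  have hθG := congrArg (bind₁ ![A', X 1]) hG
  simp only [map_sub, pderiv_mul, pderiv_C, hR1d, hwk, pderiv_X_of_ne h01, hA1, zero_mul,
    mul_zero, zero_add, add_zero, zero_sub, map_mul, map_add, map_neg, map_pow, map_natCast,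
    map_one, bind₁_C_right, hθw, hθw', hθUd, hθX, hθA, hAA'] at hE hθG
  have hP : C c * w ^ k * P = -((Ud + w') * bind₁ ![A', X 1] G) +
      w * (X 0 - 1) * bind₁ ![A', X 1] (pderiv 1 G) -
      ((k : MvPolynomial (Fin 2) ℚ) + 1) * w' * (X 0 - 1) * bind₁ ![A', X 1] G := by
    refine mul_left_cancel₀ hwne ?_
    linear_combination (C c) * hI + w * hE - (((k : MvPolynomial (Fin 2) ℚ) + 1) * w') * hθG
  -- chain rule for `θ G`
  have hG0 : pderiv 0 (bind₁ ![A', X 1] G) = w * bind₁ ![A', X 1] (pderiv 0 G) := by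
    rw [LinExact.pderiv_bind₁, Fin.sum_univ_two]
    simp only [Matrix.cons_val_zero, Matrix.cons_val_one, Matrix.cons_val_fin_one]
    rw [hA'0, pderiv_X_of_ne h10, zero_mul, add_zero]
  have hG1 : pderiv 1 (bind₁ ![A', X 1] G) =
      (Ud + w' * X 0) * bind₁ ![A', X 1] (pderiv 0 G) + bind₁ ![A', X 1] (pderiv 1 G) := by
    rw [LinExact.pderiv_bind₁, Fin.sum_univ_two]
    simp only [Matrix.cons_val_zero, Matrix.cons_val_one, Matrix.cons_val_fin_one]
    rw [hA'1, pderiv_X_self, one_mul]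
  -- the primitive `Nt = (1 − z₁)·θ(G)/c`
  have hcc : C c⁻¹ * C c = (1 : MvPolynomial (Fin 2) ℚ) := by
    rw [← C_mul, inv_mul_cancel₀ hc0, C_1]
  refine ⟨C c⁻¹ * ((1 - X 0) * bind₁ ![A', X 1] G), ?_⟩
  rw [show C (k : ℚ) = (k : MvPolynomial (Fin 2) ℚ) from map_natCast C k]
  simp only [pderiv_mul, pderiv_C, map_sub, pderiv_X_self, pderiv_X_of_ne h01,
    Derivation.map_one_eq_zero, hG0, hG1, zero_mul, zero_add, zero_sub, sub_zero]
  linear_combination (C c⁻¹) * hP - (w ^ k * P) * hcc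

end GwDivision

open GwDivision in
/-- **General-slope graph pencil, factor theorem ⇒ TWISTED IDENTITY with descent `ℝ → ℚ`**
(stub `stub_gwDivision` of the crux `TateFamilyKernel`, line `Sketch`). Given a rational
primitive `Rn/v^k` (real coefficients) of the single-branch integrand and the vanishing of the
top-interval integral along the graph `W = u + v` on `(s₁,1)`: with `Rn ↦ Rn·v` (exponent
`k + 1`), uniqueness of the derivative at `y = u(σ) + v(σ)x` and the FTC give two real polynomial
identities, `ℚ`-linear in `Rn` with rational coefficients; a `ℚ`-linear retraction `ℝ → ℚ`
applied coefficientwise (`GwDivision.exists_retraction`) transports them to `ℚ[x, s]`, and the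
factor theorem in `ℚ[s][y]` with the chain rule (`GwDivision.twisted`) yields the twisted
identity with `m = k`. The injectivity hypothesis is not used. [cite: KontsevichZagier2001, §1.2] -/
theorem stub_gwDivision (u v : Polynomial ℚ) (P : MvPolynomial (Fin 2) ℚ) (Rn : MvPolynomial (Fin 2) ℝ) (k : ℕ)
    (s₁ : ℝ) (hs₁0 : 0 ≤ s₁) (hs₁ : s₁ < 1) (hv : ∀ σ ∈ Icc (0 : ℝ) 1, Polynomial.aeval σ v ≠ 0)
    (hinj : InjOn (fun s : ℝ => Polynomial.aeval s u + Polynomial.aeval s v) (Ioo s₁ 1))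
    (hR : ∀ y σ : ℝ, σ ∈ Icc (0 : ℝ) 1 →
      HasDerivAt (fun t : ℝ => MvPolynomial.eval (![y, t] : Fin 2 → ℝ) Rn / (Polynomial.aeval t v) ^ k)
        (aeval (![(y - Polynomial.aeval σ u) / Polynomial.aeval σ v, σ] : Fin 2 → ℝ) P / Polynomial.aeval σ v) σ)
    (hzero : ∀ s ∈ Ioo s₁ 1,
      ∫ σ in Ioo s 1, aeval (![(Polynomial.aeval s u + Polynomial.aeval s v - Polynomial.aeval σ u) /
          Polynomial.aeval σ v, σ] : Fin 2 → ℝ) P / Polynomial.aeval σ v = 0) :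
    ∃ (Nt : MvPolynomial (Fin 2) ℚ) (m : ℕ),
      Polynomial.aeval (X 1 : MvPolynomial (Fin 2) ℚ) v ^ m * P =
        (Polynomial.aeval (X 1 : MvPolynomial (Fin 2) ℚ) (Polynomial.derivative u) +
            Polynomial.aeval (X 1 : MvPolynomial (Fin 2) ℚ) (Polynomial.derivative v) * X 0) * pderiv 0 Nt -
          Polynomial.aeval (X 1 : MvPolynomial (Fin 2) ℚ) v * pderiv 1 Nt +
          C (m : ℚ) * Polynomial.aeval (X 1 : MvPolynomial (Fin 2) ℚ) (Polynomial.derivative v) * Nt := by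
  have _ := hinj -- the injectivity of `u + v` is not needed: the root argument below runs in `s`
  -- names over `ℚ`: `w = v(s)`, `w' = v'(s)`, `Ud = u'(s)`, `A = u + w` (graph), `A' = u + w·z₁`,
  -- `c = v(1)^(k+1)`; over `ℝ`: `Rp = Rn·w` (exponent `k + 1`)
  obtain ⟨w, hw⟩ : ∃ w : MvPolynomial (Fin 2) ℚ, w = Polynomial.aeval (X 1) v := ⟨_, rfl⟩
  obtain ⟨w', hw'⟩ : ∃ w' : MvPolynomial (Fin 2) ℚ,
      w' = Polynomial.aeval (X 1) (Polynomial.derivative v) := ⟨_, rfl⟩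
  obtain ⟨Ud, hUd⟩ : ∃ Ud : MvPolynomial (Fin 2) ℚ,
      Ud = Polynomial.aeval (X 1) (Polynomial.derivative u) := ⟨_, rfl⟩
  obtain ⟨A, hA⟩ : ∃ A : MvPolynomial (Fin 2) ℚ, A = Polynomial.aeval (X 1) u + w := ⟨_, rfl⟩
  obtain ⟨A', hA'⟩ : ∃ A' : MvPolynomial (Fin 2) ℚ, A' = Polynomial.aeval (X 1) u + w * X 0 :=
    ⟨_, rfl⟩
  obtain ⟨c, hc⟩ : ∃ c : ℚ, c = Polynomial.eval 1 v ^ (k + 1) := ⟨_, rfl⟩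
  obtain ⟨Rp, hRp⟩ : ∃ Rp : MvPolynomial (Fin 2) ℝ, Rp = Rn * map (algebraMap ℚ ℝ) w :=
    ⟨_, rfl⟩
  have hV1 : Polynomial.aeval (1 : ℝ) v = algebraMap ℚ ℝ (Polynomial.eval 1 v) := by
    rw [← Polynomial.aeval_algebraMap_apply_eq_algebraMap_eval, map_one]
  have hv1 : Polynomial.aeval (1 : ℝ) v ≠ 0 := hv 1 ⟨zero_le_one, le_rfl⟩
  have hc0 : c ≠ 0 := by
    rw [hc]
    refine pow_ne_zero _ fun h => hv1 ?_
    rw [hV1, h, map_zero]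
  have hcR : algebraMap ℚ ℝ c = Polynomial.aeval (1 : ℝ) v ^ (k + 1) := by rw [hc, map_pow, hV1]
  have hwne : w ≠ 0 := fun h => hv1 (by
    simpa [hw, GpDivision.aeval_scalar] using congrArg (aeval (![0, 1] : Fin 2 → ℝ)) h)
  -- scalar evaluations
  have heM : ∀ (q : MvPolynomial (Fin 2) ℚ) (g : Fin 2 → ℝ),
      MvPolynomial.eval g (map (algebraMap ℚ ℝ) q) = aeval g q := fun q g => by
    rw [eval_map, aeval_def]
  have hew : ∀ g : Fin 2 → ℝ, aeval g w = Polynomial.aeval (g 1) v := fun g => by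
    rw [hw, GpDivision.aeval_scalar]
  have hew' : ∀ g : Fin 2 → ℝ, aeval g w' = Polynomial.aeval (g 1) (Polynomial.derivative v) :=
    fun g => by rw [hw', GpDivision.aeval_scalar]
  have heA : ∀ g : Fin 2 → ℝ, aeval g A = Polynomial.aeval (g 1) u + Polynomial.aeval (g 1) v :=
    fun g => by rw [hA, map_add, GpDivision.aeval_scalar, hew]
  have heA' : ∀ g : Fin 2 → ℝ,
      aeval g A' = Polynomial.aeval (g 1) u + Polynomial.aeval (g 1) v * g 0 := fun g => by
    rw [hA', map_add, map_mul, GpDivision.aeval_scalar, hew, aeval_X]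
  have hpw : pderiv 1 (map (algebraMap ℚ ℝ) w) = map (algebraMap ℚ ℝ) w' := by
    rw [pderiv_map, hw, GpDivision.pderiv_one_scalar, hw']
  -- STEP 1 (uniqueness of the derivative, read at `y = u(σ) + v(σ)x`): the real identity `I`
  have hI : map (algebraMap ℚ ℝ) (P * w ^ (k + 1)) =
      map (algebraMap ℚ ℝ) w * bind₁ ![map (algebraMap ℚ ℝ) A', X 1] (pderiv 1 Rp) -
        map (algebraMap ℚ ℝ) (((k : MvPolynomial (Fin 2) ℚ) + 1) * w') *
          bind₁ ![map (algebraMap ℚ ℝ) A', X 1] Rp := by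
    refine eq_of_eval_eq _ _ (Icc 0 1) (Icc_infinite zero_lt_one) fun x σ hσ => ?_
    have hV := hv σ hσ
    have hkey := key_identity v Rn k _ σ _ hV
      (hR (Polynomial.aeval σ u + Polynomial.aeval σ v * x) σ hσ)
    rw [add_sub_cancel_left, mul_div_cancel_left₀ _ hV] at hkey
    simp only [hRp, map_mul, map_pow, map_sub, map_add, map_natCast, map_one, heM, hew, hew',
      eval_bind₁_vec, MvPolynomial.eval_X, heA', pderiv_mul, hpw, Matrix.cons_val_zero,
      Matrix.cons_val_one, Matrix.cons_val_fin_one]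
    rw [show aeval (![x, σ] : Fin 2 → ℝ) P =
      aeval (![x, σ] : Fin 2 → ℝ) P / Polynomial.aeval σ v * Polynomial.aeval σ v by field_simp]
    linear_combination Polynomial.aeval σ v * hkey
  -- STEP 2 (FTC along the graph `y = u(s) + v(s)`): the real identity `J`
  have hφ : ∀ y : ℝ, ∀ σ ∈ Icc (0 : ℝ) 1, ContinuousAt (fun σ : ℝ =>
      aeval (![(y - Polynomial.aeval σ u) / Polynomial.aeval σ v, σ] : Fin 2 → ℝ) P /
        Polynomial.aeval σ v) σ := by
    intro y σ hσ
    refine (GvDivision.continuousAt_aeval_comp P _ σ fun i => ?_).div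
      (Polynomial.continuousAt_aeval v) (hv σ hσ)
    fin_cases i
    · simp only [Fin.zero_eta, Matrix.cons_val_zero]
      exact (continuousAt_const.sub (Polynomial.continuousAt_aeval u)).div
        (Polynomial.continuousAt_aeval v) (hv σ hσ)
    · simp only [Fin.mk_one, Matrix.cons_val_one, Matrix.cons_val_fin_one]
      exact continuousAt_id
  have hJ : bind₁ ![map (algebraMap ℚ ℝ) A, X 1] (map (algebraMap ℚ ℝ) (C c) * Rp -
      map (algebraMap ℚ ℝ) (w ^ (k + 1)) * bind₁ ![X 0, 1] Rp) = 0 := by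
    refine eq_of_eval_eq _ _ (Ioo s₁ 1) (Ioo_infinite hs₁) fun x s hs => ?_
    have hsub : Icc s 1 ⊆ Icc (0 : ℝ) 1 := Icc_subset_Icc_left (hs₁0.trans hs.1.le)
    have hVs : Polynomial.aeval s v ≠ 0 := hv s (hsub (left_mem_Icc.2 hs.2.le))
    have hint := intervalIntegral.integral_eq_sub_of_hasDerivAt
      (fun σ hσ => hR (Polynomial.aeval s u + Polynomial.aeval s v) σ
        (hsub (by rwa [uIcc_of_le hs.2.le] at hσ)))
      (ContinuousOn.intervalIntegrable_of_Icc hs.2.le fun σ hσ =>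
        (hφ _ σ (hsub hσ)).continuousWithinAt)
    rw [intervalIntegral.integral_of_le hs.2.le, integral_Ioc_eq_integral_Ioo, hzero s hs,
      eq_comm, sub_eq_zero, div_eq_div_iff (pow_ne_zero _ hv1) (pow_ne_zero _ hVs)] at hint
    simp only [hRp, map_zero, map_sub, map_mul, map_pow, map_one, heM, hew, heA, eval_bind₁_vec,
      MvPolynomial.eval_X, MvPolynomial.aeval_C, hcR, Matrix.cons_val_zero, Matrix.cons_val_one,
      Matrix.cons_val_fin_one]
    linear_combination -(Polynomial.aeval 1 v * Polynomial.aeval s v) * hint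
  -- STEP 3 (descent `ℝ → ℚ`)
  obtain ⟨ρ, hρm, hρq, hρd, hρb⟩ := exists_retraction
  have hθ : ∀ i, (![map (algebraMap ℚ ℝ) A', X 1] : Fin 2 → MvPolynomial (Fin 2) ℝ) i =
      map (algebraMap ℚ ℝ) ((![A', X 1] : Fin 2 → MvPolynomial (Fin 2) ℚ) i) := fun i => by
    fin_cases i <;> simp
  have hθA : ∀ i, (![map (algebraMap ℚ ℝ) A, X 1] : Fin 2 → MvPolynomial (Fin 2) ℝ) i =
      map (algebraMap ℚ ℝ) ((![A, X 1] : Fin 2 → MvPolynomial (Fin 2) ℚ) i) := fun i => by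
    fin_cases i <;> simp
  have hθ1 : ∀ i, (![X 0, 1] : Fin 2 → MvPolynomial (Fin 2) ℝ) i =
      map (algebraMap ℚ ℝ) ((![X 0, 1] : Fin 2 → MvPolynomial (Fin 2) ℚ) i) := fun i => by
    fin_cases i <;> simp
  have hI' := congrArg ρ hI
  rw [hρq, map_sub, hρm, hρm, hρb _ _ hθ, hρb _ _ hθ, hρd] at hI'
  have hJ' := congrArg ρ hJ
  rw [hρb _ _ hθA, map_sub, hρm, hρm, hρb _ _ hθ1, map_zero] at hJ'
  -- STEP 4 (factor theorem and chain rule over `ℚ`), `m = k`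
  obtain ⟨Nt, hNt⟩ := twisted u v P (ρ Rp) k c hc0 w w' Ud A A' hw hw' hUd hA hA' hwne hI' hJ'
  subst hw hw' hUd
  exact ⟨Nt, k, hNt⟩

end Summit.KontsevichZagierPeriods.InverseLandau.TateFamilyKernel.Descent
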